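import Summits.BirchSwinnertonDyer.BirchSwinnertonDyer.Theorems.Rank2Observatory2DescZ2OddCaseRefined
import HarnessLib

/-!
# BirchSwinnertonDyer — rank ≥ 2 observatory: the unit-parity constraint of the `μ_θ` descent at a split odd prime (ℤ/2-torsion rows)

HONEST FRAMING: per-curve certified theorems and census instruments; no claim on BSD in rank ≥ 2.

Generic piece of the successor instrument KERNEL-2DESC-Z2 (spec
`code/b2b-bsdr2-cert-3/kernel-2desc-z2/README-Z2.md`). In shape (A) of the casework
(`…Z2OddCase.classes_point_cases`: `x = n/d₀²`, `ℓ ∤ n d₀`) the refined clause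
`…Z2OddCaseRefined.oddClauseR_sound` still admits EVERY residue pair `(r, s) = (n, d₀) mod ℓ`. One
elementary constraint is missing: when `n`, `n − d₀²θ` and `n − d₀²θ'` are all `ℓ`-adic units
(`θ ↦ t`, `θ' ↦ −A − t` under the residue map of the prime), the integral curve equation
`m² = n (n² + A n d₀² + B d₀⁴) = n (n − d₀² t)(n − d₀²(−A − t)) (mod ℓ)` forces the three Legendre
symbols to multiply to `+1` (`caseA_sqb_sum_eq_zero`). `oddClauseRP_sound` is `oddClauseR_sound`
with this parity condition as a decidable antecedent of the shape-(A) obligation `hNA`; per row the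
containment is still one `decide`. On the third ℤ/2-torsion row (`428298m1`, `K = ℚ(√17)`) it cuts
the necessary sets at `13` and `19` from `6` to the sharp `4` pairs each.
Sorry-free; axioms `propext`, `Classical.choice`, `Quot.sound`.
[cite: Cassels1991LecturesEllipticCurves, §15]
-/

-- single-conjunct summit: `Summit.BirchSwinnertonDyer.BirchSwinnertonDyer.…` repeats the name by design
set_option linter.dupNamespace false

noncomputable section

open scoped NumberField

namespace Summit.BirchSwinnertonDyer.BirchSwinnertonDyer.Rank2Observatory.TwoDescZ2

/-! ## The parity constraint in shape (A) -/

section Generic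

variable {ℓ : ℕ} [Fact ℓ.Prime]

/-- Shape (A), all three factors units: `sqb n + sqb (n − d₀² t) + sqb (n − d₀² (−A − t)) = 0`.
[cite: Cassels1991LecturesEllipticCurves, §15] -/
theorem caseA_sqb_sum_eq_zero {A B : ℤ} {t₀ : ZMod ℓ}
    (ht : t₀ ^ 2 + (A : ZMod ℓ) * t₀ + (B : ZMod ℓ) = 0)
    {n e m d₀ : ℤ} (he : e = d₀ ^ 2) (hE : m ^ 2 = n * (n ^ 2 + A * n * e + B * e ^ 2))
    (hn : (n : ZMod ℓ) ≠ 0) (h₁ : (n : ZMod ℓ) - (d₀ : ZMod ℓ) ^ 2 * t₀ ≠ 0)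
    (h₂ : (n : ZMod ℓ) - (d₀ : ZMod ℓ) ^ 2 * (-(A : ZMod ℓ) - t₀) ≠ 0) :
    sqb (n : ZMod ℓ) + sqb ((n : ZMod ℓ) - (d₀ : ZMod ℓ) ^ 2 * t₀) +
      sqb ((n : ZMod ℓ) - (d₀ : ZMod ℓ) ^ 2 * (-(A : ZMod ℓ) - t₀)) = 0 := by
  have hecast : (e : ZMod ℓ) = (d₀ : ZMod ℓ) ^ 2 := by rw [he]; push_cast; ring
  have hEq : ((m : ZMod ℓ)) ^ 2 = (n : ZMod ℓ) * ((n : ZMod ℓ) - (d₀ : ZMod ℓ) ^ 2 * t₀) *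
      ((n : ZMod ℓ) - (d₀ : ZMod ℓ) ^ 2 * (-(A : ZMod ℓ) - t₀)) := by
    have h := congrArg (Int.cast : ℤ → ZMod ℓ) hE
    push_cast at h
    rw [h, hecast]
    linear_combination ((n : ZMod ℓ) * (d₀ : ZMod ℓ) ^ 4) * ht
  have h := qrOf_sq (m : ZMod ℓ)
  rw [hEq, qrOf_mul (mul_ne_zero hn h₁) h₂, qrOf_mul hn h₁, qrOf_eq_sqb, qrOf_eq_sqb, qrOf_eq_sqb] at h
  exact h

end Generic

/-! ## Soundness of the refined odd clause with parity -/

section Sound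

variable {K : Type*} [Field K] [NumberField K]

/-- **Soundness of the refined odd-prime clause with the unit-parity constraint.** As
`…Z2OddCaseRefined.oddClauseR_sound`, with the shape-(A) obligation `hNA` weakened by the decidable
antecedent `r − s²t₁ ≠ 0 → r − s²(−A − t₁) ≠ 0 → sqb r + sqb (r − s²t₁) + sqb (r − s²(−A − t₁)) = 0`
(`caseA_sqb_sum_eq_zero`). [cite: Cassels1991LecturesEllipticCurves, §15] -/
theorem oddClauseRP_sound {ℓ : ℕ} [Fact ℓ.Prime] (d₁ d₂ : SplitPrime (𝓞 K) ℓ) {A B : ℤ} {θ : 𝓞 K}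
    (hq : θ ^ 2 + (A : 𝓞 K) * θ + (B : 𝓞 K) = 0) (hθ0 : θ ≠ 0)
    (hθQ : ∀ q : ℚ, algebraMap ℚ K q ≠ algebraMap (𝓞 K) K θ)
    {t₁ t₂ : ZMod ℓ} (ht₁ : d₁.res θ = t₁) (ht₂ : d₂.res θ = t₂)
    (hs₁ : (A : ZMod ℓ) + 2 * t₁ ≠ 0) (hs₂ : (A : ZMod ℓ) + 2 * t₂ ≠ 0)
    {c₁ c₂ : ZMod 2} (hc₁ : qrOf (d₁.res d₁.π') = c₁) (hc₂ : qrOf (d₂.res d₂.π') = c₂)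
    {k₁ k₂ : ℕ} {β₁ β₂ : 𝓞 K} (hθp₁ : -θ = d₁.π ^ k₁ * β₁) (hβ₁ : d₁.res β₁ ≠ 0)
    (hθp₂ : -θ = d₂.π ^ k₂ * β₂) (hβ₂ : d₂.res β₂ ≠ 0)
    {nθ₁ nθ₂ : ZMod 2 × ZMod 2} (hnθ₁ : bitsAt d₁ (-θ) = nθ₁) (hnθ₂ : bitsAt d₂ (-θ) = nθ₂)
    {m s : ℕ} {Wu : Fin m → (𝓞 K)ˣ} {G : Fin s → 𝓞 K} (hG0 : ∀ j, G j ≠ 0)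
    {bu₁ bu₂ : Fin m → ZMod 2 × ZMod 2} {bg₁ bg₂ : Fin s → ZMod 2 × ZMod 2}
    (hbu₁ : ∀ i, bitsAt d₁ (Wu i : 𝓞 K) = bu₁ i) (hbu₂ : ∀ i, bitsAt d₂ (Wu i : 𝓞 K) = bu₂ i)
    (hbg₁ : ∀ j, bitsAt d₁ (G j) = bg₁ j) (hbg₂ : ∀ j, bitsAt d₂ (G j) = bg₂ j)
    (N : Finset ((ZMod 2 × ZMod 2) × (ZMod 2 × ZMod 2)))
    (hNA : ∀ r s : ZMod ℓ, r ≠ 0 → s ≠ 0 →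
      (r - s ^ 2 * t₁ ≠ 0 → r - s ^ 2 * (-(A : ZMod ℓ) - t₁) ≠ 0 →
        sqb r + sqb (r - s ^ 2 * t₁) + sqb (r - s ^ 2 * (-(A : ZMod ℓ) - t₁)) = 0) →
      (clsA A t₁ r s, clsA A t₂ r s) ∈ N)
    (hNB : (((0 : ZMod 2), (0 : ZMod 2)), ((0 : ZMod 2), (0 : ZMod 2))) ∈ N)
    (hNC : ∀ v : ℕ, v < k₁ + k₂ + 3 → 1 ≤ v → ∀ r s : ZMod ℓ, r ≠ 0 → s ≠ 0 →
      (v < k₁ → clsC A t₁ c₁ (v : ZMod 2) r s = ((v : ZMod 2), (v : ZMod 2) * c₁ + sqb r)) →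
      (k₁ < v → clsC A t₁ c₁ (v : ZMod 2) r s = nθ₁) →
      (v < k₂ → clsC A t₂ c₂ (v : ZMod 2) r s = ((v : ZMod 2), (v : ZMod 2) * c₂ + sqb r)) →
      (k₂ < v → clsC A t₂ c₂ (v : ZMod 2) r s = nθ₂) →
      (clsC A t₁ c₁ (v : ZMod 2) r s, clsC A t₂ c₂ (v : ZMod 2) r s) ∈ N)
    (hN0 : (nθ₁, nθ₂) ∈ N)
    {x y : ℚ} (hE : y ^ 2 = x ^ 3 + A * x ^ 2 + B * x) (T : Finset (Fin m)) (U : Finset (Fin s))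
    (hsq : IsSquare ((algebraMap ℚ K x - algebraMap (𝓞 K) K θ) *
      (∏ i ∈ T, algebraMap (𝓞 K) K (Wu i : 𝓞 K)) * ∏ j ∈ U, algebraMap (𝓞 K) K (G j))) :
    (∑ i ∈ T, bu₁ i + ∑ j ∈ U, bg₁ j, ∑ i ∈ T, bu₂ i + ∑ j ∈ U, bg₂ j) ∈ N := by
  -- the residue of the minimal relation at the first prime: `t₁² + A t₁ + B = 0`
  have ht₁q : t₁ ^ 2 + (A : ZMod ℓ) * t₁ + (B : ZMod ℓ) = 0 := by
    have h := congrArg d₁.res hq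
    rw [map_add, map_add, map_mul, map_pow, map_intCast, map_intCast, _root_.map_zero, ht₁] at h
    exact h
  set wTU : 𝓞 K := (∏ i ∈ T, (Wu i : 𝓞 K)) * ∏ j ∈ U, G j with hw
  have hw0 : wTU ≠ 0 := mul_ne_zero (Finset.prod_ne_zero_iff.mpr fun i _ => (Wu i).ne_zero)
    (Finset.prod_ne_zero_iff.mpr fun j _ => hG0 j)
  have hsq' : IsSquare ((algebraMap ℚ K x - algebraMap (𝓞 K) K θ) * algebraMap (𝓞 K) K wTU) := by
    rw [hw, map_mul, map_prod, map_prod, ← mul_assoc]; exact hsq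
  obtain ⟨n, d₀, mm, hd₀, hcop, hx, hEZ⟩ := exists_integral_form hE
  have hx' : x = (n : ℚ) / ((d₀ ^ 2 : ℤ) : ℚ) := by rw [hx, Int.cast_pow]
  have hα : (n : 𝓞 K) - ((d₀ ^ 2 : ℤ) : 𝓞 K) * θ ≠ 0 := sub_ne_zero_of_not_rat hθQ (pow_ne_zero 2 hd₀)
  have hT₁ := bitsAt_point_eq_of_isSquare d₁ (rfl : (d₀ ^ 2 : ℤ) = d₀ ^ 2) hd₀ hx' hα hw0 hsq'
  have hT₂ := bitsAt_point_eq_of_isSquare d₂ (rfl : (d₀ ^ 2 : ℤ) = d₀ ^ 2) hd₀ hx' hα hw0 hsq'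
  rw [← bitsAt_w_eq d₁ hG0 hbu₁ hbg₁ T U, ← bitsAt_w_eq d₂ hG0 hbu₂ hbg₂ T U, ← hT₁, ← hT₂]
  by_cases hn : n = 0
  · -- the torsion point `x = 0`: the class of `−θ`
    have hd₀R : ((d₀ : 𝓞 K)) ≠ 0 := by exact_mod_cast hd₀
    have hneg : (n : 𝓞 K) - ((d₀ ^ 2 : ℤ) : 𝓞 K) * θ = (-θ) * (d₀ : 𝓞 K) ^ 2 := by
      rw [hn]; push_cast; ring
    rw [hneg, bitsAt_mul (neg_ne_zero.mpr hθ0) (pow_ne_zero 2 hd₀R),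
      bitsAt_mul (neg_ne_zero.mpr hθ0) (pow_ne_zero 2 hd₀R), bitsAt_sq hd₀R, bitsAt_sq hd₀R,
      add_zero, add_zero, hnθ₁, hnθ₂]
    exact hN0
  · have hℓp : Prime (ℓ : ℤ) := Nat.prime_iff_prime_int.mp (Fact.out : ℓ.Prime)
    have hcop' : ¬ ((ℓ : ℤ) ∣ n ∧ (ℓ : ℤ) ∣ d₀) := not_dvd_and_dvd_of_isCoprime hcop hℓp.not_unit
    by_cases hln : (ℓ : ℤ) ∣ n
    · -- case (C), refined
      have hd₀n : ¬ (ℓ : ℤ) ∣ d₀ := fun h => hcop' ⟨hln, h⟩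
      have hd₀' : (d₀ : ZMod ℓ) ≠ 0 := fun h => hd₀n ((ZMod.intCast_zmod_eq_zero_iff_dvd d₀ ℓ).mp h)
      obtain ⟨v, n₀, hn₀, hv⟩ := WfDvdMonoid.max_power_factor' hn hℓp.not_unit
      have hv1 : 1 ≤ v := by
        by_contra h0
        have : v = 0 := by omega
        rw [this, pow_zero, one_mul] at hv
        exact hn₀ (hv ▸ hln)
      have hn₀' : (n₀ : ZMod ℓ) ≠ 0 := fun h => hn₀ ((ZMod.intCast_zmod_eq_zero_iff_dvd n₀ ℓ).mp h)
      have hC₁ := bitsAt_point_caseC hq ht₁ hs₁ hc₁ hv hv1 hn₀ rfl hEZ hd₀' hα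
      have hC₂ := bitsAt_point_caseC hq ht₂ hs₂ hc₂ hv hv1 hn₀ rfl hEZ hd₀' hα
      obtain ⟨v', hv'b, hv'1, hmod, i1, i2, i3, i4⟩ := exists_level_rep k₁ k₂ hv1
      have hvv : (v' : ZMod 2) = (v : ZMod 2) := (ZMod.natCast_eq_natCast_iff' v' v 2).mpr hmod
      rw [hC₁, hC₂, ← hvv]
      refine hNC v' hv'b hv'1 _ _ hn₀' hd₀' ?_ ?_ ?_ ?_
      · intro h
        rw [hvv, ← hC₁, bitsAt_point_caseC_lt hθp₁ hv hn₀ (i1.mpr h), hc₁, qrOf_eq_sqb]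
      · intro h
        rw [hvv, ← hC₁, bitsAt_point_caseC_gt hθp₁ hβ₁ hv hn₀ rfl hd₀' (i2.mpr h), hnθ₁]
      · intro h
        rw [hvv, ← hC₂, bitsAt_point_caseC_lt hθp₂ hv hn₀ (i3.mpr h), hc₂, qrOf_eq_sqb]
      · intro h
        rw [hvv, ← hC₂, bitsAt_point_caseC_gt hθp₂ hβ₂ hv hn₀ rfl hd₀' (i4.mpr h), hnθ₂]
    · have hn' : (n : ZMod ℓ) ≠ 0 := fun h => hln ((ZMod.intCast_zmod_eq_zero_iff_dvd n ℓ).mp h)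
      by_cases hld : (ℓ : ℤ) ∣ d₀
      · -- case (B), refined: `n` is a square mod `ℓ`
        have hd₀' : (d₀ : ZMod ℓ) = 0 := (ZMod.intCast_zmod_eq_zero_iff_dvd d₀ ℓ).mpr hld
        rw [bitsAt_point_caseB ht₁ rfl hn' hd₀', bitsAt_point_caseB ht₂ rfl hn' hd₀',
          caseB_sqb_eq_zero (A := A) (B := B) rfl hEZ hn' hd₀']
        exact hNB
      · -- case (A), with the parity constraint when all three factors are units
        have hd₀' : (d₀ : ZMod ℓ) ≠ 0 := fun h => hld ((ZMod.intCast_zmod_eq_zero_iff_dvd d₀ ℓ).mp h)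
        rw [bitsAt_point_caseA hq ht₁ hs₁ rfl hEZ hn' hd₀' hα, bitsAt_point_caseA hq ht₂ hs₂ rfl hEZ hn' hd₀' hα]
        exact hNA _ _ hn' hd₀' (fun h₁ h₂ => caseA_sqb_sum_eq_zero ht₁q rfl hEZ hn' h₁ h₂)

end Sound

end Summit.BirchSwinnertonDyer.BirchSwinnertonDyer.Rank2Observatory.TwoDescZ2

end
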